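import Summits.KontsevichZagierPeriods.Zeta5Search.LaiSweepShard

/-!
# `κ₃` sweep certificate — shard file 046 of 127 (shards 322–328 of 889)

HONEST FRAMING. Systematic search; no irrationality claim unless certified. This file only checks,
by `decide +kernel`, shards 322–328 of the order-cell sweep of the `κ₃` point `(74, 2180, 444; δ74)`
(engine `LaiSweepEngine`, soundness `LaiSweepJump/Free/Eval/Shard/Kappa3`; a shard is `⟨regime, n,
p, q, p', q', Lo, Up⟩`: `n` cells from `p/q` to `p'/q'` with integer rate sums in `[Lo, Up]`, `K =
128`, `D = 2^40`). It draws NO conclusion: only the capstone `LaiKappa3SweepCert`, which needs all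
127 shard files, does. Kernel cost of this file ≈ 560 cells × 0.3 s.
-/

namespace Summit.KontsevichZagierPeriods.Zeta5Search.Sweep

set_option maxHeartbeats 100000000 in
/-- Shard 322: 80 cells of regime B from `1379/4804` to `111/385`.
[cite: Lai2024BallRivoal, §4 Lemma 4.3] -/
theorem shard322 :
    Shard.check 128 (2^40)
      ⟨true, 80, 1379, 4804, 111, 385, 23519246749618, 25047870518506⟩ = true := by
  decide +kernel

set_option maxHeartbeats 100000000 in
/-- Shard 323: 80 cells of regime B from `111/385` to `75/259`.
[cite: Lai2024BallRivoal, §4 Lemma 4.3] -/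
theorem shard323 :
    Shard.check 128 (2^40)
      ⟨true, 80, 111, 385, 75, 259, 23526098616961, 25070661562821⟩ = true := by
  decide +kernel

set_option maxHeartbeats 100000000 in
/-- Shard 324: 80 cells of regime B from `75/259` to `57/196`.
[cite: Lai2024BallRivoal, §4 Lemma 4.3] -/
theorem shard324 :
    Shard.check 128 (2^40)
      ⟨true, 80, 75, 259, 57, 196, 23012256517837, 24537835621555⟩ = true := by
  decide +kernel

set_option maxHeartbeats 100000000 in
/-- Shard 325: 80 cells of regime B from `57/196` to `59/202`.
[cite: Lai2024BallRivoal, §4 Lemma 4.3] -/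
theorem shard325 :
    Shard.check 128 (2^40)
      ⟨true, 80, 57, 196, 59, 202, 23331913957847, 24894038966052⟩ = true := by
  decide +kernel

set_option maxHeartbeats 100000000 in
/-- Shard 326: 80 cells of regime B from `59/202` to `127/433`.
[cite: Lai2024BallRivoal, §4 Lemma 4.3] -/
theorem shard326 :
    Shard.check 128 (2^40)
      ⟨true, 80, 59, 202, 127, 433, 22525612042668, 24047934744490⟩ = true := by
  decide +kernel

set_option maxHeartbeats 100000000 in
/-- Shard 327: 80 cells of regime B from `127/433` to `109/370`.
[cite: Lai2024BallRivoal, §4 Lemma 4.3] -/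
theorem shard327 :
    Shard.check 128 (2^40)
      ⟨true, 80, 127, 433, 109, 370, 23683659431327, 25301131192280⟩ = true := by
  decide +kernel

set_option maxHeartbeats 100000000 in
/-- Shard 328: 80 cells of regime B from `109/370` to `71/240`.
[cite: Lai2024BallRivoal, §4 Lemma 4.3] -/
theorem shard328 :
    Shard.check 128 (2^40)
      ⟨true, 80, 109, 370, 71, 240, 22630886570125, 24190285752302⟩ = true := by
  decide +kernel

/-- The checked shards of this file, in order. [folklore] -/
def shards046 : List (CheckedShard 128 (2^40)) :=
  [⟨_, shard322⟩, ⟨_, shard323⟩, ⟨_, shard324⟩, ⟨_, shard325⟩, ⟨_, shard326⟩,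
    ⟨_, shard327⟩, ⟨_, shard328⟩]

end Summit.KontsevichZagierPeriods.Zeta5Search.Sweep
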